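import Mathlib
import HarnessLib
import Literature.Analysis.FluidPDE.ClassicalSolution
import Literature.Analysis.FluidPDE.ClassicalSolutionRescale
import Literature.Analysis.FluidPDE.SuitableWeak
import Summits.NavierStokesRegularity.NavierStokesRegularity.Theorems.QuarterLogPincerTypeIQuantSubcubicExpZoomSlice

/-!
# Crux `QuarterLogPincer.TypeIQuantSubcubicExp` (stmt-NavierStokesRegularity-24077), line `thin_cascade`:
  the zooms of cheap cascades BLOW UP on every backward cylinder `Q(0, R)` along any subsequence

Helper file (`--supports stmt-NavierStokesRegularity-24077 --as helper`, lead prover ns-tc-p1) toward the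
registered stub `stub_thinObjectExtraction` (skeleton v5), part (3) «`SingularAt` of the zoom limit»,
step 3 of the plan attached to the item (`S2-PLAN-v5-remaining.md`): the persistence clause of
`LocalTypeIBlowup.local_typeI_compactness_singular` asks that the approximants blow up in `L^∞(Q(0,R))`
for every `R > 0` along the extracted subsequence,
`limsup_j ‖w_{σ j}‖_{L^∞(Q(0,R))} = ∞`.  For the zooms `w_K = ρ_K • stPull (ρ_K²) ρ_K T_K x₀^K u_K` of
cheap cascades this holds along EVERY subsequence (`limsup_eLpNorm_top_zoom_eq_top`): `w_K` is continuous
up to its final slice (the frame is classical on the closed interval `[0, T_K]`), so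
`‖w_K‖_{L^∞(Q(0,R))} ≥ ‖w_K(s, 0)‖ → ‖w_K(0,0)‖ = ρ_K‖u_K(T_K, x₀^K)‖ ≥ e^K` (`s → 0⁻`; the cylinder is
inside the zoomed life as soon as `R² ≤ e^{2K}`), and `e^{σ j} → ∞`.

* `enorm_le_eLpNorm_top_of_continuousOn_open` — a function continuous on an open set is bounded there
  by its `L^∞` norm (positivity of open sets; private-style copy of the tree's
  `enorm_le_eLpNorm_top_of_continuousOn_isOpen`, `Ferrari1993MoserInequality.lean`, kept here to avoid
  that file's import closure);
* `ofReal_exp_le_eLpNorm_top_zoom` — `e^K ≤ ‖w_K‖_{L^∞(Q(0,R))}` once `R² ≤ e^{2K}`;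
* `limsup_eLpNorm_top_zoom_eq_top` — the blow-up along any strictly increasing `σ`.

HONEST FRAMING: bookkeeping toward one registered stub of an open crux; nothing about Navier–Stokes
regularity is proved; no summit statement is proved by this file.
-/

noncomputable section

-- the summit-side namespace `Summit.NavierStokesRegularity.NavierStokesRegularity.…` (single-conjunct summit,
-- D-0017) repeats a component by design; the dupNamespace linter would flag every declaration.
set_option linter.dupNamespace false

namespace Summit.NavierStokesRegularity.NavierStokesRegularity.Theorems.ThinCascade

open MeasureTheory Set Function Filter Topology Metric
open scoped ENNReal NNReal
open Literature.Analysis Literature.Analysis.FluidPDE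

/-- **A function continuous on an open set is bounded there by its essential supremum** (Lebesgue
measure is positive on nonempty open sets): `‖h x‖ₑ ≤ ‖h‖_{L^∞(O)}` for `x ∈ O`. [folklore] -/
theorem enorm_le_eLpNorm_top_of_continuousOn_open {X : Type*} [MeasurableSpace X]
    [TopologicalSpace X] [OpensMeasurableSpace X] {μ : Measure X} [μ.IsOpenPosMeasure]
    {G : Type*} [NormedAddCommGroup G] {O : Set X} (hO : IsOpen O) {h : X → G}
    (hh : ContinuousOn h O) {x : X} (hx : x ∈ O) :
    ‖h x‖ₑ ≤ eLpNorm h ∞ (μ.restrict O) := by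
  -- adapted from Literature/Analysis/FluidPDE/Ferrari1993MoserInequality.lean
  by_contra hlt
  push Not at hlt
  set S : ℝ≥0∞ := eLpNorm h ∞ (μ.restrict O) with hS
  have hae : ∀ᵐ y ∂(μ.restrict O), ‖h y‖ₑ ≤ S := by
    rw [hS, eLpNorm_exponent_top]
    exact enorm_ae_le_eLpNormEssSup h _
  set W : Set X := O ∩ (fun y => ‖h y‖ₑ) ⁻¹' Ioi S with hW_def
  have hW : IsOpen W :=
    (continuous_enorm.comp_continuousOn hh).isOpen_inter_preimage hO isOpen_Ioi
  have hxW : x ∈ W := ⟨hx, hlt⟩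
  have hpos : 0 < μ W := hW.measure_pos μ ⟨x, hxW⟩
  have hzero : μ.restrict O W = 0 := by
    refine measure_mono_null (fun y hy => ?_) (ae_iff.1 hae)
    exact not_le.2 hy.2
  rw [Measure.restrict_apply' hO.measurableSet, inter_eq_left.2 inter_subset_left] at hzero
  exact hpos.ne' hzero

/-- **`e^K ≤ ‖w_K‖_{L^∞(Q(0,R))}`** for the zoom `w = ρ • stPull (ρ²) ρ T x₀ u` of a cheap cascade of
length `K` (Tao frame classical on `[0,T]`, `e^{2K}ρ² ≤ T`, centre value `ρ‖u(T,x₀)‖ ≥ e^K`), as soon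
as the cylinder fits in the zoomed life, `R² ≤ e^{2K}`: `‖w(s,0)‖ ≤ ‖w‖_{L^∞(Q(0,R))}` for
`−R² < s < 0` by continuity on the open cylinder, and `‖w(s,0)‖ → ‖w(0,0)‖ ≥ e^K` as `s → 0⁻` by
continuity up to the final slice. [folklore] -/
theorem ofReal_exp_le_eLpNorm_top_zoom {T ρ R : ℝ} {K : ℕ} {x₀ : EuclideanSpace ℝ (Fin 3)}
    {u : ℝ → EuclideanSpace ℝ (Fin 3) → EuclideanSpace ℝ (Fin 3)}
    {p : ℝ → EuclideanSpace ℝ (Fin 3) → ℝ}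
    (hcl₀ : IsClassicalNSSolutionOn (Icc 0 T) 1 0 u p) (hρ : 0 < ρ)
    (hlife : Real.exp (2 * K) * ρ ^ 2 ≤ T) (hcentre : Real.exp K ≤ ρ * ‖u T x₀‖)
    (hR : 0 < R) (hRK : R ^ 2 ≤ Real.exp (2 * K)) :
    ENNReal.ofReal (Real.exp K) ≤
      eLpNorm (uncurry (ρ • stPull (ρ ^ 2) ρ T x₀ u)) ∞
        (volume.restrict (parabolicCylinder R (0 : ℝ × EuclideanSpace ℝ (Fin 3)))) := by
  set w := ρ • stPull (ρ ^ 2) ρ T x₀ u with hw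
  set Q : Set (ℝ × EuclideanSpace ℝ (Fin 3)) :=
    parabolicCylinder R (0 : ℝ × EuclideanSpace ℝ (Fin 3)) with hQ
  set N : ℝ≥0∞ := eLpNorm (uncurry w) ∞ (volume.restrict Q) with hN
  have hρ2 : 0 < ρ ^ 2 := by positivity
  -- the zoom is classical, hence continuous, on the preimage time set `S ⊇ [−R², 0]`
  set S : Set ℝ := (fun r => T + ρ ^ 2 * r) ⁻¹' Icc 0 T with hS
  have hcl : IsClassicalNSSolutionOn S 1 0 w (ρ ^ 2 • stPull (ρ ^ 2) ρ T x₀ p) :=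
    hcl₀.nsRescale_translate_zero hρ T x₀
  have hIcc : Icc (-R ^ 2) 0 ⊆ S := by
    intro s hs
    rw [hS, mem_preimage, mem_Icc]
    refine ⟨?_, by nlinarith [hs.2]⟩
    have h1 : ρ ^ 2 * (-R ^ 2) ≤ ρ ^ 2 * s := mul_le_mul_of_nonneg_left hs.1 hρ2.le
    have h2 : ρ ^ 2 * R ^ 2 ≤ T := le_trans (by nlinarith) hlife
    nlinarith
  have hcont : ContinuousOn (uncurry w) (S ×ˢ univ) := hcl.smooth_velocity.continuousOn
  have hQS : Q ⊆ S ×ˢ univ := by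
    intro z hz
    rw [hQ, mem_parabolicCylinder] at hz
    obtain ⟨⟨h1, h2⟩, -⟩ := hz
    simp only [Prod.fst_zero, zero_sub] at h1 h2
    exact ⟨hIcc ⟨h1.le, h2.le⟩, mem_univ _⟩
  -- `‖w(s, 0)‖ₑ ≤ N` for `−R² < s < 0`
  have hle : ∀ s ∈ Ioo (-R ^ 2) 0, ‖w s 0‖ₑ ≤ N := by
    intro s hs
    have hmem : ((s, (0 : EuclideanSpace ℝ (Fin 3))) : ℝ × EuclideanSpace ℝ (Fin 3)) ∈ Q := by
      rw [hQ, mem_parabolicCylinder]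
      simp only [Prod.fst_zero, Prod.snd_zero, zero_sub, dist_self]
      exact ⟨hs, hR⟩
    have h := enorm_le_eLpNorm_top_of_continuousOn_open (μ := volume)
      (isOpen_parabolicCylinder R (0 : ℝ × EuclideanSpace ℝ (Fin 3))) (hcont.mono hQS) hmem
    rw [Function.uncurry_apply_pair] at h
    exact h
  -- `‖w(s, 0)‖ₑ → ‖w(0, 0)‖ₑ` as `s → 0⁻`
  have hg : ContinuousOn (fun s : ℝ => w s 0) (Icc (-R ^ 2) 0) := by
    have e : (fun s : ℝ => w s 0) = uncurry w ∘ fun s => (s, (0 : EuclideanSpace ℝ (Fin 3))) := rfl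
    rw [e]
    refine hcont.comp (Continuous.prodMk_left 0).continuousOn ?_
    intro s hs
    exact ⟨hIcc hs, mem_univ _⟩
  have h0mem : (0 : ℝ) ∈ Icc (-R ^ 2) 0 := ⟨by nlinarith, le_rfl⟩
  have htend : Tendsto (fun s : ℝ => ‖w s 0‖ₑ) (𝓝[<] 0) (𝓝 ‖w 0 0‖ₑ) := by
    have h1 : Tendsto (fun s : ℝ => w s 0) (𝓝[Icc (-R ^ 2) 0] 0) (𝓝 (w 0 0)) := hg 0 h0mem
    have h2 : Tendsto (fun s : ℝ => w s 0) (𝓝[Ioo (-R ^ 2) 0] 0) (𝓝 (w 0 0)) :=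
      tendsto_nhdsWithin_mono_left Ioo_subset_Icc_self h1
    rw [nhdsWithin_Ioo_eq_nhdsLT (by nlinarith : -R ^ 2 < (0 : ℝ))] at h2
    exact (continuous_enorm.tendsto _).comp h2
  have hev : ∀ᶠ s in 𝓝[<] (0 : ℝ), ‖w s 0‖ₑ ≤ N := by
    have : Ioo (-R ^ 2) (0 : ℝ) ∈ 𝓝[<] (0 : ℝ) := Ioo_mem_nhdsLT (by nlinarith)
    filter_upwards [this] with s hs using hle s hs
  have hN : ‖w 0 0‖ₑ ≤ N := le_of_tendsto htend hev
  -- `‖w(0,0)‖ ≥ e^K`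
  calc ENNReal.ofReal (Real.exp K) ≤ ENNReal.ofReal ‖w 0 0‖ :=
        ENNReal.ofReal_le_ofReal (zoom_center_ge hρ hcentre)
    _ = ‖w 0 0‖ₑ := ofReal_norm _
    _ ≤ N := hN

/-- **The zooms of cheap cascades blow up on every `Q(0, R)` along any subsequence.**  For a family
of cheap-cascade witnesses `(T_K, ρ_K, x₀^K, u_K, p_K)` (Tao frame classical on `[0, T_K]`,
`e^{2K}ρ_K² ≤ T_K`, centre values `ρ_K‖u_K(T_K, x₀^K)‖ ≥ e^K`), every strictly increasing `σ : ℕ → ℕ`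
and every `R > 0`: `limsup_j ‖w_{σ j}‖_{L^∞(Q(0,R))} = ∞`, where
`w_K = ρ_K • stPull (ρ_K²) ρ_K T_K x₀^K u_K` — the persistence hypothesis of
`LocalTypeIBlowup.local_typeI_compactness_singular`. [folklore] -/
theorem limsup_eLpNorm_top_zoom_eq_top {T ρ : ℕ → ℝ} {x₀ : ℕ → EuclideanSpace ℝ (Fin 3)}
    {u : ℕ → ℝ → EuclideanSpace ℝ (Fin 3) → EuclideanSpace ℝ (Fin 3)}
    {p : ℕ → ℝ → EuclideanSpace ℝ (Fin 3) → ℝ}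
    (hcl : ∀ K, IsClassicalNSSolutionOn (Icc 0 (T K)) 1 0 (u K) (p K)) (hρ : ∀ K, 0 < ρ K)
    (hlife : ∀ K : ℕ, Real.exp (2 * K) * ρ K ^ 2 ≤ T K)
    (hcentre : ∀ K : ℕ, Real.exp K ≤ ρ K * ‖u K (T K) (x₀ K)‖)
    {σ : ℕ → ℕ} (hσ : StrictMono σ) {R : ℝ} (hR : 0 < R) :
    limsup (fun j => eLpNorm
        (uncurry ((ρ (σ j)) • stPull (ρ (σ j) ^ 2) (ρ (σ j)) (T (σ j)) (x₀ (σ j)) (u (σ j)))) ∞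
        (volume.restrict (parabolicCylinder R (0 : ℝ × EuclideanSpace ℝ (Fin 3))))) atTop = ⊤ := by
  set N : ℕ → ℝ≥0∞ := fun j => eLpNorm
    (uncurry ((ρ (σ j)) • stPull (ρ (σ j) ^ 2) (ρ (σ j)) (T (σ j)) (x₀ (σ j)) (u (σ j)))) ∞
    (volume.restrict (parabolicCylinder R (0 : ℝ × EuclideanSpace ℝ (Fin 3)))) with hNdef
  -- the lower bound `e^{σ j}` eventually, and `e^{σ j} → ∞`
  have hexp : Tendsto (fun k : ℕ => Real.exp (2 * (k : ℝ))) atTop atTop :=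
    Real.tendsto_exp_atTop.comp (tendsto_natCast_atTop_atTop.const_mul_atTop (by norm_num : (0 : ℝ) < 2))
  have hevK : ∀ᶠ k : ℕ in atTop, R ^ 2 ≤ Real.exp (2 * (k : ℝ)) := hexp.eventually_ge_atTop _
  have hevj : ∀ᶠ j : ℕ in atTop, ENNReal.ofReal (Real.exp (σ j)) ≤ N j := by
    filter_upwards [hσ.tendsto_atTop.eventually hevK] with j hj
    exact ofReal_exp_le_eLpNorm_top_zoom (hcl _) (hρ _) (hlife _) (hcentre _) hR hj
  have hg : Tendsto (fun j : ℕ => ENNReal.ofReal (Real.exp (σ j))) atTop (𝓝 ⊤) := by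
    refine ENNReal.tendsto_ofReal_atTop.comp ?_
    exact Real.tendsto_exp_atTop.comp (tendsto_natCast_atTop_atTop.comp hσ.tendsto_atTop)
  have h1 : liminf (fun j : ℕ => ENNReal.ofReal (Real.exp (σ j))) atTop = ⊤ := hg.liminf_eq
  have h2 : liminf (fun j : ℕ => ENNReal.ofReal (Real.exp (σ j))) atTop ≤ liminf N atTop :=
    liminf_le_liminf hevj
  have h3 : liminf N atTop ≤ limsup N atTop := liminf_le_limsup
  exact top_le_iff.1 (h1 ▸ h2.trans h3)

end Summit.NavierStokesRegularity.NavierStokesRegularity.Theorems.ThinCascade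

end
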